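import Mathlib
import Literature.NumberTheory.Sieve.PolynomialCongruencesPrimeModuli

/-!
# The squarefree sieve for `μ(f(n))` along a progression (`OmegaToMobiusAP`, stmt-Parity-11588)

For an integer quadratic `f = A X² + B X + C` (`natDegree f = 2`) write `g(n) = f(n).toNat`,
`s(n) = (−1)^{ω(g n)}`, and fix `q ≥ 1`, `a`, a sieve level `R ≥ 1` and the modulus
`M = q · (R!)²`.  Let `P_R(c)` say that no prime `p ≤ R` has `p² ∣ f(c)`; for `n` with `f(n) > 0`
this property of `c = n mod M` is exactly "`g(n)` has no square prime factor `≤ R`".  The core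
estimate these lemmas feed (`core_estimate`, in `IsogenyRedeiOmegaToMobiusAP`) is

`|Σ_{n ≤ x, n ≡ a (q)} μ(g n) − Σ_{c < M, c ≡ a (q), P_R(c)} Σ_{n ≤ x, n ≡ c (M)} s(n)|
   ≤ 2 N₀ + 2x/R + 2 π(B x)`,

valid whenever `f(n) > 0` for `n ≥ N₀`, `f(n) ≤ B x²` on `[1, x]` (`B ≥ 1`), and every prime
`p > R` satisfies `p ∤ 2A(B² − 4AC)` (then `[1, x]` contains `≤ 2(x/p² + 1)` roots of `f` modulo
`p²`, `card_roots_Icc_le` of `IsogenyRedeiOmegaToMobiusAPCounting`).  This file: the shape of the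
quadratic (`quadratic_pos`, `quadratic_le`; `f(n) = A n² + B n + C` and `disc ≠ 0` are reused from
`Literature.NumberTheory.Sieve.PolynomialCongruencesPrimeModuli`), periodicity of
the small-prime condition, the pointwise error (`abs_pointwise_error_le`: `μ(m) = (−1)^{ω(m)}·1[m
squarefree]`, and for `n ≥ N₀` the indicator `1[P_R(n mod M)]` differs from `1[g(n) squarefree]`
only if some prime `p ∈ (R, Bx]` has `p² ∣ f(n)`), and the large-prime tail `sum_local_bounds_le`.
Imports `Mathlib` and one Literature file.
-/

open Finset Polynomial

namespace Summit.Parity.BatemanHorn.Theorems.OmegaToMobiusAP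

/-! ### The quadratic -/

/-! The shape `f(n) = A n² + B n + C` (`eval_eq_of_natDegree_eq_two`) and the non-vanishing of
the discriminant of an irreducible quadratic (`discrim_ne_zero_of_irreducible`) are taken from
`Literature.NumberTheory.Sieve` (file `PolynomialCongruencesPrimeModuli`). -/

/-- `A n² + B n + C > 0` for `A ≥ 1` and `n ≥ |B| + |C| + 1`. [folklore] -/
theorem quadratic_pos {A B C n : ℤ} (hA : 0 < A) (hn : |B| + |C| + 1 ≤ n) :
    0 < A * n ^ 2 + B * n + C := by
  have hB := abs_nonneg B
  have hC := abs_nonneg C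
  have hn0 : 0 < n := by linarith
  have h1 : n ^ 2 ≤ A * n ^ 2 := by nlinarith
  have h2 : -(|B| * n) ≤ B * n := by nlinarith [neg_abs_le B]
  have h3 : -|C| ≤ C := neg_abs_le C
  have h4 : |B| * n + |C| < n ^ 2 := by
    nlinarith [mul_nonneg (sub_nonneg.mpr hn) hn0.le,
      mul_nonneg (sub_nonneg.mpr (show (1 : ℤ) ≤ n by linarith)) hC]
  nlinarith

/-- `A n² + B n + C ≤ (A + |B| + |C|) x²` for `A ≥ 1` and `1 ≤ n ≤ x`. [folklore] -/
theorem quadratic_le {A B C n x : ℤ} (hA : 0 < A) (hn1 : 1 ≤ n) (hnx : n ≤ x) :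
    A * n ^ 2 + B * n + C ≤ (A + |B| + |C|) * x ^ 2 := by
  have hx1 : 1 ≤ x := hn1.trans hnx
  have hnx2 : n ≤ x ^ 2 := by nlinarith
  have h1 : A * n ^ 2 ≤ A * x ^ 2 := by
    have : n ^ 2 ≤ x ^ 2 := by nlinarith
    nlinarith
  have h2 : B * n ≤ |B| * x ^ 2 := by
    have e1 : B * n ≤ |B| * n := by nlinarith [le_abs_self B]
    have e2 : |B| * n ≤ |B| * x ^ 2 := mul_le_mul_of_nonneg_left hnx2 (abs_nonneg B)
    linarith
  have h3 : C ≤ |C| * x ^ 2 := by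
    have e1 : C ≤ |C| := le_abs_self C
    have e2 : |C| ≤ |C| * x ^ 2 := by
      have : (1 : ℤ) ≤ x ^ 2 := by nlinarith
      nlinarith [abs_nonneg C]
    linarith
  nlinarith

/-! ### Periodicity of the small-prime condition -/

/-- `p² ∣ f(n)` depends only on `n` modulo any multiple `M` of `p²`. [folklore] -/
theorem sq_dvd_eval_iff_of_modEq (f : ℤ[X]) {p M n c : ℕ} (hpM : p ^ 2 ∣ M)
    (hnc : n ≡ c [MOD M]) :
    (p : ℤ) ^ 2 ∣ f.eval (n : ℤ) ↔ (p : ℤ) ^ 2 ∣ f.eval (c : ℤ) := by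
  apply dvd_iff_dvd_of_dvd_sub
  have h1 : (M : ℤ) ∣ (n : ℤ) - (c : ℤ) := Nat.modEq_iff_dvd.mp hnc.symm
  have h2 : (p : ℤ) ^ 2 ∣ (M : ℤ) := by exact_mod_cast hpM
  exact (h2.trans h1).trans (Polynomial.sub_dvd_eval_sub _ _ _)

/-- For a prime `p ≤ R`, `p²` divides the sieve modulus `q · (R!)²`. [folklore] -/
theorem sq_dvd_modulus {p R : ℕ} (hp : p.Prime) (hpR : p ≤ R) (q : ℕ) :
    p ^ 2 ∣ q * Nat.factorial R ^ 2 :=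
  Dvd.dvd.mul_left (pow_dvd_pow_of_dvd (Nat.dvd_factorial hp.pos hpR) 2) q

/-! ### The pointwise error -/

/-- `|μ(m)| ≤ 1` in `ℝ`. [folklore] -/
theorem abs_cast_moebius_le_one (m : ℕ) : |(ArithmeticFunction.moebius m : ℝ)| ≤ 1 := by
  have h := ArithmeticFunction.abs_moebius_le_one (n := m)
  have : ((|ArithmeticFunction.moebius m| : ℤ) : ℝ) ≤ 1 := by exact_mod_cast h
  simpa [Int.cast_abs] using this

/-- **Pointwise error.** With `g n = f(n).toNat`, `s n = (−1)^{ω(g n)}`, `χ n = 1[P_R(n mod M)]`: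
`|s(n) χ(n) − μ(g n)| ≤ 2·1[n < N₀] + Σ_{p prime, R < p ≤ Bx} 1[p² ∣ f(n)]` for `1 ≤ n ≤ x`.
[folklore] -/
theorem abs_pointwise_error_le (f : ℤ[X]) (N₀ : ℕ) (hN₀ : ∀ n : ℕ, N₀ ≤ n → 0 < f.eval (n : ℤ))
    (Bh : ℕ) (hBh1 : 1 ≤ Bh)
    (hBh : ∀ n x : ℕ, 1 ≤ n → n ≤ x → f.eval (n : ℤ) ≤ (Bh : ℤ) * (x : ℤ) ^ 2)
    (q R : ℕ) {x n : ℕ} (hn : n ∈ Finset.Icc 1 x) :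
    |(-1 : ℝ) ^ ArithmeticFunction.cardDistinctFactors ((f.eval (n : ℤ)).toNat) *
          (if ∀ p ∈ Finset.range (R + 1), p.Prime →
              ¬ ((p : ℤ) ^ 2 ∣ f.eval (((n % (q * Nat.factorial R ^ 2) : ℕ)) : ℤ))
            then (1 : ℝ) else 0)
        - (ArithmeticFunction.moebius ((f.eval (n : ℤ)).toNat) : ℝ)|
      ≤ 2 * (if n < N₀ then (1 : ℝ) else 0)
        + ∑ p ∈ (Nat.primesLE (Bh * x)).filter (fun p => R < p),
            (if (p : ℤ) ^ 2 ∣ f.eval (n : ℤ) then (1 : ℝ) else 0) := by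
  set M := q * Nat.factorial R ^ 2 with hM
  set m := (f.eval (n : ℤ)).toNat with hm
  have hsum_nonneg : 0 ≤ ∑ p ∈ (Nat.primesLE (Bh * x)).filter (fun p => R < p),
      (if (p : ℤ) ^ 2 ∣ f.eval (n : ℤ) then (1 : ℝ) else 0) :=
    Finset.sum_nonneg (fun p _ => by split_ifs <;> norm_num)
  rw [Finset.mem_Icc] at hn
  by_cases hnN : n < N₀
  · -- trivial bound 2
    rw [if_pos hnN, mul_one]
    have h1 : |(-1 : ℝ) ^ ArithmeticFunction.cardDistinctFactors m *
          (if ∀ p ∈ Finset.range (R + 1), p.Prime →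
              ¬ ((p : ℤ) ^ 2 ∣ f.eval (((n % M : ℕ)) : ℤ)) then (1 : ℝ) else 0)| ≤ 1 := by
      rw [abs_mul, abs_pow, abs_neg, abs_one, one_pow, one_mul]
      split_ifs <;> simp
    have h2 := abs_cast_moebius_le_one m
    calc _ ≤ |(-1 : ℝ) ^ ArithmeticFunction.cardDistinctFactors m *
          (if ∀ p ∈ Finset.range (R + 1), p.Prime →
              ¬ ((p : ℤ) ^ 2 ∣ f.eval (((n % M : ℕ)) : ℤ)) then (1 : ℝ) else 0)|
            + |(ArithmeticFunction.moebius m : ℝ)| := abs_sub _ _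
      _ ≤ 1 + 1 := add_le_add h1 h2
      _ ≤ 2 + _ := by linarith
  · -- n ≥ N₀ : f(n) > 0
    push Not at hnN
    rw [if_neg (not_lt.mpr hnN), mul_zero, zero_add]
    have hpos : 0 < f.eval (n : ℤ) := hN₀ n hnN
    have hmcast : ((m : ℕ) : ℤ) = f.eval (n : ℤ) := Int.toNat_of_nonneg hpos.le
    have hm0 : m ≠ 0 := by
      intro h0
      rw [h0] at hmcast
      simp at hmcast
      linarith
    -- divisibility transfer between `m` and `f(n)`
    have hdvd_iff : ∀ p : ℕ, p ^ 2 ∣ m ↔ (p : ℤ) ^ 2 ∣ f.eval (n : ℤ) := by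
      intro p
      rw [← hmcast, ← Int.natCast_dvd_natCast]
      push_cast
      exact Iff.rfl
    -- periodicity at the small primes
    have hper : ∀ p ∈ Finset.range (R + 1), p.Prime →
        ((p : ℤ) ^ 2 ∣ f.eval (n : ℤ) ↔ (p : ℤ) ^ 2 ∣ f.eval (((n % M : ℕ)) : ℤ)) := by
      intro p hp hpp
      have hpR : p ≤ R := Nat.lt_succ_iff.mp (Finset.mem_range.mp hp)
      exact sq_dvd_eval_iff_of_modEq f (sq_dvd_modulus hpp hpR q) (Nat.mod_modEq n M).symm
    by_cases hsq : Squarefree m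
    · -- μ = (−1)^ω and χ = 1
      have hP : ∀ p ∈ Finset.range (R + 1), p.Prime →
          ¬ ((p : ℤ) ^ 2 ∣ f.eval (((n % M : ℕ)) : ℤ)) := by
        intro p hp hpp hd
        have h1 : p ^ 2 ∣ m := (hdvd_iff p).mpr ((hper p hp hpp).mpr hd)
        rw [pow_two] at h1
        exact (Nat.squarefree_iff_prime_squarefree.mp hsq) p hpp h1
      rw [if_pos hP, mul_one]
      have hμ : (ArithmeticFunction.moebius m : ℝ) =
          (-1 : ℝ) ^ ArithmeticFunction.cardDistinctFactors m := by
        rw [ArithmeticFunction.moebius_apply_of_squarefree hsq,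
          ← (ArithmeticFunction.cardDistinctFactors_eq_cardFactors_iff_squarefree hm0).mpr hsq]
        push_cast
        ring
      rw [hμ, sub_self, abs_zero]
      exact hsum_nonneg
    · -- μ = 0; if χ = 1 there is a prime p ∈ (R, Bx] with p² ∣ f(n)
      rw [ArithmeticFunction.moebius_eq_zero_of_not_squarefree hsq, Int.cast_zero, sub_zero]
      split_ifs with hP
      · rw [mul_one, abs_pow, abs_neg, abs_one, one_pow]
        -- get the prime
        obtain ⟨p, hpp, hpm⟩ : ∃ p : ℕ, p.Prime ∧ p * p ∣ m := by
          by_contra hcon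
          push Not at hcon
          exact hsq (Nat.squarefree_iff_prime_squarefree.mpr (fun p hp => hcon p hp))
        rw [← pow_two] at hpm
        have hpf : (p : ℤ) ^ 2 ∣ f.eval (n : ℤ) := (hdvd_iff p).mp hpm
        have hRp : R < p := by
          by_contra hle
          push Not at hle
          have hpr : p ∈ Finset.range (R + 1) := Finset.mem_range.mpr (Nat.lt_succ_of_le hle)
          exact hP p hpr hpp ((hper p hpr hpp).mp hpf)
        have hpB : p ≤ Bh * x := by
          have h1 : p ^ 2 ≤ m := Nat.le_of_dvd (Nat.pos_of_ne_zero hm0) hpm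
          have h2 : (m : ℤ) ≤ (Bh : ℤ) * (x : ℤ) ^ 2 := hmcast ▸ hBh n x hn.1 hn.2
          have h3 : ((p ^ 2 : ℕ) : ℤ) ≤ (((Bh * x) ^ 2 : ℕ) : ℤ) := by
            have hB2 : (Bh : ℤ) * (x : ℤ) ^ 2 ≤ ((Bh : ℤ) * x) ^ 2 := by
              have : (Bh : ℤ) ≤ (Bh : ℤ) ^ 2 := by
                have hB1 : (1 : ℤ) ≤ Bh := by exact_mod_cast hBh1
                nlinarith
              nlinarith [sq_nonneg (x : ℤ)]
            push_cast
            calc ((p : ℤ)) ^ 2 = ((p ^ 2 : ℕ) : ℤ) := by push_cast; ring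
              _ ≤ (m : ℤ) := by exact_mod_cast h1
              _ ≤ (Bh : ℤ) * (x : ℤ) ^ 2 := h2
              _ ≤ ((Bh : ℤ) * x) ^ 2 := hB2
          have h4 : p ^ 2 ≤ (Bh * x) ^ 2 := by exact_mod_cast h3
          exact (Nat.pow_le_pow_iff_left two_ne_zero).mp h4
        have hpmem : p ∈ (Nat.primesLE (Bh * x)).filter (fun p => R < p) := by
          rw [Finset.mem_filter, Nat.mem_primesLE]
          exact ⟨⟨hpB, hpp⟩, hRp⟩
        calc (1 : ℝ) = (if (p : ℤ) ^ 2 ∣ f.eval (n : ℤ) then (1 : ℝ) else 0) := by rw [if_pos hpf]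
          _ ≤ _ := Finset.single_le_sum (f := fun p : ℕ =>
                (if (p : ℤ) ^ 2 ∣ f.eval (n : ℤ) then (1 : ℝ) else 0))
              (fun p _ => by split_ifs <;> norm_num) hpmem
      · rw [mul_zero, abs_zero]
        exact hsum_nonneg

/-! ### Summing the error -/

/-- The large-prime tail: `Σ_{p prime, R < p ≤ Bx} 2 (x/p² + 1) ≤ 2x/R + 2 π(Bx)` (`R ≥ 1`),
by `Σ_{m > R} 1/m² ≤ 1/R`. [folklore] -/
theorem sum_local_bounds_le (R Bh x : ℕ) (hR : 0 < R) :
    ∑ p ∈ (Nat.primesLE (Bh * x)).filter (fun p => R < p), (2 * ((x / p ^ 2 : ℕ) + 1 : ℝ))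
      ≤ 2 * x / R + 2 * (Nat.primesLE (Bh * x)).card := by
  have hsub : (Nat.primesLE (Bh * x)).filter (fun p => R < p) ⊆ Finset.Ioc R (Bh * x) := by
    intro p hp
    rw [Finset.mem_filter, Nat.mem_primesLE] at hp
    rw [Finset.mem_Ioc]
    exact ⟨hp.2, hp.1.1⟩
  have h1 : ∀ p ∈ (Nat.primesLE (Bh * x)).filter (fun p => R < p),
      (2 * ((x / p ^ 2 : ℕ) + 1 : ℝ)) ≤ 2 * x * ((p : ℝ) ^ 2)⁻¹ + 2 := by
    intro p hp
    have hp0 : (0 : ℝ) < (p : ℝ) ^ 2 := by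
      have : 0 < p := lt_of_le_of_lt (Nat.zero_le R) (Finset.mem_filter.mp hp).2
      positivity
    have : ((x / p ^ 2 : ℕ) : ℝ) ≤ (x : ℝ) / (p : ℝ) ^ 2 := by
      have := Nat.cast_div_le (m := x) (n := p ^ 2) (α := ℝ)
      push_cast at this
      exact this
    rw [div_eq_mul_inv] at this
    linarith
  calc _ ≤ ∑ p ∈ (Nat.primesLE (Bh * x)).filter (fun p => R < p),
          (2 * x * ((p : ℝ) ^ 2)⁻¹ + 2) := Finset.sum_le_sum h1
    _ = 2 * x * ∑ p ∈ (Nat.primesLE (Bh * x)).filter (fun p => R < p), ((p : ℝ) ^ 2)⁻¹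
          + 2 * ((Nat.primesLE (Bh * x)).filter (fun p => R < p)).card := by
        rw [Finset.sum_add_distrib, Finset.mul_sum, Finset.sum_const, nsmul_eq_mul]
        ring
    _ ≤ 2 * x * (1 / R) + 2 * (Nat.primesLE (Bh * x)).card := by
        gcongr
        · calc ∑ p ∈ (Nat.primesLE (Bh * x)).filter (fun p => R < p), ((p : ℝ) ^ 2)⁻¹
              ≤ ∑ m ∈ Finset.Ioc R (Bh * x), ((m : ℝ) ^ 2)⁻¹ :=
                Finset.sum_le_sum_of_subset_of_nonneg hsub (fun m _ _ => by positivity)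
            _ ≤ 1 / R := by
                rcases le_or_gt R (Bh * x) with hle | hlt
                · calc _ ≤ (R : ℝ)⁻¹ - ((Bh * x : ℕ) : ℝ)⁻¹ := sum_Ioc_inv_sq_le_sub hR.ne' hle
                    _ ≤ 1 / R := by
                        rw [one_div]
                        have : (0 : ℝ) ≤ ((Bh * x : ℕ) : ℝ)⁻¹ := by positivity
                        linarith
                · rw [Finset.Ioc_eq_empty (not_lt.mpr hlt.le), Finset.sum_empty]
                  positivity
        · exact Finset.filter_subset _ _
    _ = 2 * x / R + 2 * (Nat.primesLE (Bh * x)).card := by ring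

end Summit.Parity.BatemanHorn.Theorems.OmegaToMobiusAP
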